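import Summits.CriticalPhenomena.PercolationContinuityZ3.Theorems.PercNearOneGluingNoHeavyQuantSliceLowsBelowBudget
import Summits.CriticalPhenomena.PercolationContinuityZ3.Theorems.PercNearOneGluingNoHeavyQuantSliceDeepShallowLows
import Summits.CriticalPhenomena.PercolationContinuityZ3.Theorems.PercNearOneGluingNoHeavyQuantSliceMidsBelow
import HarnessLib

/-!
# QUANT lane R8, T-DEC: **THEOREM D — SL-λ* WITH DEEP, FAR-DEEP AND SHALLOW LOWS** (shallow / far-deep lows `≤ λ`; band-like atoms; true
# mids with `k + a ≤ j′`; window true mids; giants; giant-copy atoms incompatible with the lows; `g ≥ 1/2`) (LEAD-NOTES-G23 N50 (4), N51)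

builds on p205010 (kernel theorem, internal audit signed; external expert review pending)

Support file (`--supports stmt-CriticalPhenomena-4575`), QUANT lane lead seat prim-quant-lead (gen 23), rung R8 of
`run/shared/lean/prim/quant/LADDER.md`.  Theorems only; standard axioms, no sorries.  Assembly of Theorem D from part 1
(`…QuantSliceLowsBelowBudget`), Theorem A⁺'s core (`slice_isFlowAtT_of_deepShallowLows_core`), Theorem C's pieces (`mbFlow`,
`bdecAtT_subflowLaw`, `slice_linear`), the typer's `slice_decAtT_of_bdecAtT'` and census-2's `decAtT_finite_mixture`.

**`slice_decAtT_of_lowsBelow`** — see part 1 for the statement in words.  With `λ = λ*` (least true window mid − 1) the window-mid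
condition is automatic and window lows above `λ*` do not exist (N51 (2)); the theorem is CONJECTURE SL-λ* (README V253) at every floor
`x ≥ 1/2` for every support EXCEPT shallow lows meeting a band-like atom whose shifted copy is a giant (the local BAND PIECE of census-1
g19, README V268; typer g24's `LawDec.BandTwoBlobDEC`).
Contains Theorems A, A⁺, C and the typer's single-low theorem.

[this work]; nothing here is cited as a published result.  The gluing rows served [cite: KozmaNitzan2024, Conjecture 3 (p. 15)]; product
measure [cite: Grimmett1999, §1.3 p. 10].
-/

noncomputable section

namespace Summit.CriticalPhenomena.PercolationContinuityZ3.Theorems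

namespace Quant

open Finset

namespace LawDec

section LowsBelowMain

variable (x T g : ℝ) (j' M a lam : ℕ) (ν : ℕ → ℝ)

/-- **THEOREM D (lead g23, N50 (4), N51): SL-λ* WITH DEEP, FAR-DEEP AND SHALLOW LOWS.**  As Theorem C, but charged lows may be SHALLOW
(`T′ ≤ 2(k+a)`) or FAR-DEEP (`j′ < k + a`) with `k ≤ λ`, provided every charged non-low atom `h ≤ λ` whose shifted copy is a giant
(`h + a > j′`) is incompatible at `T` with every charged low (`l + h ≤ T`).  The low hypothesis `hlows` is implied by `habove` — see the
corollary `slice_decAtT_of_lowsBelow'` (THEOREM D′) below, which drops it.  Residue of SL-λ* at `g ≥ 1/2` after this theorem: the local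
BAND PIECE (a shallow low meeting a band-like atom with a giant copy; README V268).  DOCSTRING OF THE C VERSION FOLLOWS FOR THE SHARED
ARCHITECTURE.
**THEOREM C (lead g23, N50 (3)): SL-λ* WITH TRUE MIDS BELOW THE WINDOW.**  Probability law `ν` on `{0..M}`, `0 < x < 1`, `1 ≤ a ≤ j′`,
`x ≤ g ≤ 1`, `1/2 ≤ g`, `λ ≤ j′ ≤ λ + a`.  SUPPORT: every charged low `≤ j′` is deep; every charged non-low `k ≤ λ` is band-like (`2k ≤ T′`) OR a
true mid below the window (`k + a ≤ j′`); every charged atom in `(λ, j′]` has `2k > T′`.  THEN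
`DECAtT x T j′ M ν ∧ DECAtT x T λ M ν ⟹ DECAtT x (T + a·g) j′ (M + a) (slice ν a g)`.
PROOF: corner witness at `j′` (`cornerWitness`); its `M_b` columns (`mbFlow`) are sliced componentwise (`bdecAtT_subflowLaw` +
`slice_decAtT_of_bdecAtT'`), the residual datum by Theorem A's core (`slice_isFlowAtT_of_deepLows_core`) with the pool budget
`pool_budget_midsBelow` (corner identity); the two slices recombine by `decAtT_finite_mixture`. [this work] -/
theorem slice_decAtT_of_lowsBelow (hx0 : 0 < x) (hx1 : x < 1) (hxg : x ≤ g) (hg1 : g ≤ 1) (hg2 : 1 / 2 ≤ g)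
    (ha : 1 ≤ a) (haj : a ≤ j') (hν : ∀ k, 0 ≤ ν k) (hνM : ∀ k, M < k → ν k = 0)
    (hν1 : ∑ h ∈ Finset.range (M + 1), ν h = 1)
    (hdj : DECAtT x T j' M ν) (hdl : DECAtT x T lam M ν) (hlamj : lam ≤ j') (hlam : j' ≤ lam + a)
    (hlows : ∀ k, k ≤ j' → 2 * (k : ℝ) < T → ν k ≠ 0 →
      (2 * ((k : ℝ) + a) < T + (a : ℝ) * g ∧ k + a ≤ j') ∨ ((T + (a : ℝ) * g ≤ 2 * ((k : ℝ) + a) ∨ j' < k + a) ∧ k ≤ lam))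
    (hcopy : ∀ h, h ≤ lam → T ≤ 2 * (h : ℝ) → ν h ≠ 0 → j' < h + a →
      ∀ l, l ≤ j' → 2 * (l : ℝ) < T → ν l ≠ 0 → (l : ℝ) + h ≤ T)
    (habove : ∀ k, lam < k → k ≤ j' → ν k ≠ 0 → T + (a : ℝ) * g < 2 * (k : ℝ)) :
    DECAtT x (T + (a : ℝ) * g) j' (M + a) (slice ν a g) := by
  classical
  have hg0 : 0 ≤ g := hx0.le.trans hxg
  have hu : 0 < x / (1 - x) := div_pos hx0 (by linarith)
  -- corner certificates at the two layers
  have hCj : CornerSucceeds x T j' M ν :=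
    (flowAtT_iff_cornerSucceeds x T j' M ν hx0 hx1 hν).1 (flowAtT_of_decAtT x T j' M ν hx0 hx1 hdj)
  have hCl : CornerSucceeds x T lam M ν :=
    (flowAtT_iff_cornerSucceeds x T lam M ν hx0 hx1 hν).1 (flowAtT_of_decAtT x T lam M ν hx0 hx1 hdl)
  set fB := mbFlow x T j' M a ν with hfB
  set νR := mbResidual x T j' M a ν with hνRdef
  set fR := mbResidualFlow x T j' M a ν with hfRdef
  have hW := isFlowAtT_cornerWitness x T j' M ν hx0 hx1 hν hCj
  have hB0 : ∀ l h, 0 ≤ fB l h := fun l h => (mbFlow_nonneg_le x T j' M a ν hx0 hx1 hν hCj l h).1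
  have hBle : ∀ l h, fB l h ≤ cornerWitness x T j' M ν l h :=
    fun l h => (mbFlow_nonneg_le x T j' M a ν hx0 hx1 hν hCj l h).2
  have hR : IsFlowAtT x T j' M νR fR := isFlowAtT_residual_of_subflow x T j' M ν _ fB hx0 hx1 hW hB0 hBle
  have hνR0 : ∀ k, 0 ≤ νR k := residual_nonneg_of_subflow x T j' M ν _ fB hx0 hx1 hνM hW hB0 hBle
  have hsub0 : ∀ k, 0 ≤ subflowLaw x T j' M fB k := subflowLaw_nonneg x T j' M ν _ fB hx0 hx1 hW hB0 hBle
  have hνRle : ∀ k, νR k ≤ ν k := fun k => by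
    show ν k - subflowLaw x T j' M fB k ≤ ν k; linarith [hsub0 k]
  have eR : ∀ k, νR k = ν k - subflowLaw x T j' M fB k := fun k => rfl
  have hsuble : ∀ k, subflowLaw x T j' M fB k ≤ ν k := fun k => by linarith [hνR0 k, eR k]
  have hνRM : ∀ k, M < k → νR k = 0 := fun k hk => le_antisymm (by linarith [hνRle k, hνM k hk]) (hνR0 k)
  have hsubM : ∀ k, M < k → subflowLaw x T j' M fB k = 0 := fun k hk => le_antisymm (by linarith [hsuble k, hνM k hk]) (hsub0 k)
  have hneR : ∀ k, νR k ≠ 0 → ν k ≠ 0 := fun k hk hz => hk (le_antisymm (by linarith [hνRle k]) (hνR0 k))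
  have hlowsR : ∀ k, k ≤ j' → 2 * (k : ℝ) < T → νR k ≠ 0 →
      (2 * ((k : ℝ) + a) < T + (a : ℝ) * g ∧ k + a ≤ j') ∨ ((T + (a : ℝ) * g ≤ 2 * ((k : ℝ) + a) ∨ j' < k + a) ∧ k ≤ lam) :=
    fun k hk hlow hne => hlows k hk hlow (hneR k hne)
  have haboveR : ∀ k, lam < k → k ≤ j' → νR k ≠ 0 → T + (a : ℝ) * g < 2 * (k : ℝ) :=
    fun k hk hkj hne => habove k hk hkj (hneR k hne)
  -- every charged M_b pair stays below the layer after the shift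
  have hBa : ∀ l h, 0 < fB l h → h + a ≤ j' := fun l h hp => (mbFlow_pos x T j' M a ν hx0 hx1 hν l h hp).1
  -- the residual datum sliced by Theorem A⁺'s core
  have hPB := pool_budget_lowsBelow x T g j' M a lam ν hx0 hx1 hg0 hg1 hg2 hν hνM hlamj hlam hCj hCl hlows hcopy habove
  have hcore := slice_isFlowAtT_of_deepShallowLows_core x T g j' M a lam νR fR hx0 hx1 hxg hg1 ha haj hνR0 hνRM hR hlamj hlam
    hlowsR haboveR hPB
  -- masses
  set c := ∑ l ∈ Finset.range (j' + 1), ∑ h ∈ Finset.range (M + 1), fB l h / (1 - pairGate x T l h) with hcdef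
  have hmassB : ∑ k ∈ Finset.range (M + 1), subflowLaw x T j' M fB k = c :=
    subflowLaw_mass x T j' M ν _ fB hx0 hx1 hνM hW hB0 hBle (fun l h hp => (hBa l h hp).trans' (Nat.le_add_right h a) |> fun hh => by omega)
  have hmassR : ∑ k ∈ Finset.range (M + 1), νR k = 1 - c := by
    have : ∑ k ∈ Finset.range (M + 1), νR k = ∑ k ∈ Finset.range (M + 1), ν k - ∑ k ∈ Finset.range (M + 1), subflowLaw x T j' M fB k := by
      rw [← Finset.sum_sub_distrib]; exact Finset.sum_congr rfl fun k _ => eR k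
    rw [this, hν1, hmassB]
  have hc0 : 0 ≤ c := by rw [← hmassB]; exact Finset.sum_nonneg fun k _ => hsub0 k
  have hc1 : c ≤ 1 := by
    have : 0 ≤ ∑ k ∈ Finset.range (M + 1), νR k := Finset.sum_nonneg fun k _ => hνR0 k
    linarith
  -- degenerate masses: a nonnegative law of mass 0 vanishes
  have hsubz : c = 0 → ∀ k, subflowLaw x T j' M fB k = 0 := by
    intro hc k
    by_cases hk : k ≤ M
    · have := (Finset.sum_eq_zero_iff_of_nonneg (fun k _ => hsub0 k)).1 (hmassB.trans hc) k (Finset.mem_range.2 (by omega))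
      exact this
    · exact hsubM k (by omega)
  have hνRz : c = 1 → ∀ k, νR k = 0 := by
    intro hc k
    by_cases hk : k ≤ M
    · have h0 : ∑ k ∈ Finset.range (M + 1), νR k = 0 := by rw [hmassR, hc]; ring
      exact (Finset.sum_eq_zero_iff_of_nonneg (fun k _ => hνR0 k)).1 h0 k (Finset.mem_range.2 (by omega))
    · exact hνRM k (by omega)
  -- the two normalised slices
  set μ₁ : ℕ → ℝ := slice (fun k => subflowLaw x T j' M fB k / c) a g with hμ₁
  set μ₂ : ℕ → ℝ := slice (fun k => νR k / (1 - c)) a g with hμ₂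
  have hmix : ∀ h, slice ν a g h = c * μ₁ h + (1 - c) * μ₂ h := by
    intro h
    have eν : ν = fun k => 1 * subflowLaw x T j' M fB k + 1 * νR k := by
      funext k; show ν k = 1 * subflowLaw x T j' M fB k + 1 * (ν k - subflowLaw x T j' M fB k); ring
    have e1 : c * μ₁ h = slice (fun k => subflowLaw x T j' M fB k) a g h := by
      by_cases hc : c = 0
      · have hz := hsubz hc
        simp only [hμ₁, slice, hz, hc]; simp
      · simp only [hμ₁, slice]
        split_ifs
        · field_simp
        · simp only [mul_zero, add_zero]; field_simp
    have e2 : (1 - c) * μ₂ h = slice (fun k => νR k) a g h := by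
      by_cases hc : c = 1
      · have hz := hνRz hc
        simp only [hμ₂, slice, hz, hc]; simp
      · have hne : (1:ℝ) - c ≠ 0 := sub_ne_zero.2 (Ne.symm hc)
        simp only [hμ₂, slice]
        split_ifs
        · field_simp
        · simp only [mul_zero, add_zero]; field_simp
    rw [e1, e2, eν, slice_linear]; ring
  refine decAtT_finite_mixture x (T + (a : ℝ) * g) j' (M + a) (slice ν a g) (fun b : Bool => if b then c else 1 - c)
    (fun b => if b then μ₁ else μ₂) (fun b => by cases b <;> simp [hc0, hc1]) (by simp)
    (fun h => by simp [hmix h]) ?_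
  intro b hb
  cases b with
  | true =>
    -- the component part: BDECAtT, then the typer's light/heavy two-blob slice theorem
    rw [if_pos rfl] at hb ⊢
    have hBD := bdecAtT_subflowLaw x T j' M ν _ fB hx0 hx1 hνM hW hB0 hBle a hBa c hcdef hb
    exact slice_decAtT_of_bdecAtT' x T g j' M a _ hx0 hx1 hxg hg1 ha hBD
  | false =>
    rw [if_neg Bool.false_ne_true] at hb ⊢
    have hb' : 0 < 1 - c := hb
    -- scale the residual witness to mass one
    have hsc := hcore.smul (1 / (1 - c)) (div_nonneg zero_le_one hb'.le)
    have eμ : (fun k => 1 / (1 - c) * slice νR a g k) = μ₂ := by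
      funext k; simp only [hμ₂]; unfold slice
      split_ifs
      · field_simp
      · simp only [mul_zero, add_zero]; field_simp
    rw [eμ] at hsc
    have hflow : FlowAtT x (T + (a : ℝ) * g) j' (M + a) μ₂ := ⟨_, hsc⟩
    have hμ₂M : ∀ h, M + a < h → μ₂ h = 0 := fun h hh => by
      simp only [hμ₂]; exact slice_eq_zero _ a g M (fun k hk => by rw [hνRM k hk, zero_div]) h hh
    have hμ₂1 : ∑ h ∈ Finset.range (M + a + 1), μ₂ h = 1 := by
      simp only [hμ₂]
      refine sum_slice _ a g M (fun k hk => by rw [hνRM k hk, zero_div]) ?_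
      rw [← Finset.sum_div, hmassR, div_self hb'.ne']
    exact decAtT_of_flowAtT x _ j' (M + a) μ₂ hx0 hx1 hμ₂M hμ₂1 hflow

/-- **THEOREM D′ (lead g23, N51): SL-λ for every law whose charged window atoms above `λ` are true mids and whose giant-copy non-lows
`h ≤ λ` (`h + a > j′`) meet no charged low.**  Probability law `ν` on `{0..M}`, `0 < x < 1`, `1 ≤ a ≤ j′`, `x ≤ g ≤ 1`, `1/2 ≤ g`,
`λ ≤ j′ ≤ λ + a`; THEN `DECAtT x T j′ M ν ∧ DECAtT x T λ M ν ⟹ DECAtT x (T + a·g) j′ (M + a) (slice ν a g)`.  This is Theorem D with its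
low hypothesis discharged: a charged low `k ≤ j′` is either near-deep (`2(k+a) < T′ ∧ k + a ≤ j′`) or shallow-or-far-deep, and `k ≤ λ`
because charged atoms in `(λ, j′]` are heavy at `T′ ≥ T > 2k`.  With `λ = λ*` (least true window mid − 1, or `j′` if there is none) the
window hypothesis is automatic, so at floors `x ≥ 1/2` CONJECTURE SL-λ* (README V253) is reduced to laws containing a charged giant-copy
non-low `h ≤ λ*` compatible with a charged low — by N51 (3)(a) a band-like `h` and a shallow low: the BAND PIECE. [this work] -/
theorem slice_decAtT_of_lowsBelow' (hx0 : 0 < x) (hx1 : x < 1) (hxg : x ≤ g) (hg1 : g ≤ 1) (hg2 : 1 / 2 ≤ g)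
    (ha : 1 ≤ a) (haj : a ≤ j') (hν : ∀ k, 0 ≤ ν k) (hνM : ∀ k, M < k → ν k = 0)
    (hν1 : ∑ h ∈ Finset.range (M + 1), ν h = 1)
    (hdj : DECAtT x T j' M ν) (hdl : DECAtT x T lam M ν) (hlamj : lam ≤ j') (hlam : j' ≤ lam + a)
    (hcopy : ∀ h, h ≤ lam → T ≤ 2 * (h : ℝ) → ν h ≠ 0 → j' < h + a →
      ∀ l, l ≤ j' → 2 * (l : ℝ) < T → ν l ≠ 0 → (l : ℝ) + h ≤ T)
    (habove : ∀ k, lam < k → k ≤ j' → ν k ≠ 0 → T + (a : ℝ) * g < 2 * (k : ℝ)) :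
    DECAtT x (T + (a : ℝ) * g) j' (M + a) (slice ν a g) := by
  have hag : 0 ≤ (a : ℝ) * g := mul_nonneg (Nat.cast_nonneg a) (hx0.le.trans hxg)
  refine slice_decAtT_of_lowsBelow x T g j' M a lam ν hx0 hx1 hxg hg1 hg2 ha haj hν hνM hν1 hdj hdl hlamj hlam ?_ hcopy habove
  intro k hk hlow hne
  by_cases hd : 2 * ((k : ℝ) + a) < T + (a : ℝ) * g ∧ k + a ≤ j'
  · exact Or.inl hd
  · refine Or.inr ⟨?_, ?_⟩
    · rcases not_and_or.1 hd with h1 | h1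
      · exact Or.inl (not_lt.1 h1)
      · exact Or.inr (not_le.1 h1)
    · by_contra hkl
      have := habove k (not_le.1 hkl) hk hne
      linarith

end LowsBelowMain

end LawDec

end Quant

end Summit.CriticalPhenomena.PercolationContinuityZ3.Theorems
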